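import Literature.NumberTheory.LFunctions.Zhang2022.KnifeEdgeLenZDegreeShortDenseDual

/-!
# Zhang (2022), rung F-S3 (Landau–Siegel programme, §D edge len = E*-len⁺): route `ZDegreeToeplitzBand` —
# the DENSITY LEG of the darkness ports, PROVED: polynomial short pairs are `𝔅`-dense in the kinked short pairs,
# `𝔅 ≤ C·(sup² + ‖·′‖²_{L²})`, and the three short cells reduce to K0 + darkness on polynomial short pairs

Y. Zhang, *Discrete mean estimates and the Landau–Siegel zero*, arXiv:2211.02515v1 [Zhang2022LandauSiegel] — an
unrefereed manuscript under adjudication. **WHAT THIS IS NOT: not a claim about Theorems 1–2 of arXiv:2211.02515, about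
Landau–Siegel zeros, or about Parity. The programme SEARCHES and TYPES; no claim about Landau–Siegel zeros, Theorems 1–2
of arXiv:2211.02515 or a repaired Margin232 until a kernel theorem says so.** `E₀`-free; NO new open `Prop` is introduced
here — the darkness inputs of Part 4 are spelled in the existing vocabulary (`CrossTablePsiOn`, `DualCrossTablePsiOn`,
p516582) and stay hypotheses; the side tables K0 (`InClassMean c′`, stmt-Parity-20016) stay a hypothesis.

WHAT IS HERE (the «darkness PORTS» of the toeplitz closure squad, cell landau-siegel §D, WAVE-2 chain #1 (i);
ls-lead WAVE2-INPUT v1.0 87bec0cb73599e09 §1a; director-frontier 13:20:35Z 2026-08-27). The in-tree density REDUCTIONS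
`crossTablePsiOn_zero_of_dense` (p521442), `dualCrossTablePsiOn_zero_of_dense` (p528742) and
`tauTwoDarkShort_of_dense[_eventually]` turn «dark on a sub-class `𝒞₀` + K0 + `𝔅`-APPROXIMATION of the class by `𝒞₀`» into
«dark on the class», but their approximation hypothesis — the (D11″) pair «`𝔅`-density of piecewise-polynomial short pairs
in the kinked short pairs» + «`𝔅(w) ≤ C_𝔅‖w‖²_{H¹}`» of the K1″a hand's DISPLAY #2 §E (K1A-DISPLAY-2-dipole.md v1.1
9270e546693b3568; ls-knife-typer-1 g9 HANDOFF (ii): «UNTYPED debt of the `crossTablePsiOn_zero_of_dense` rung») — was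
never typed. This leaf PROVES it for the smallest natural sub-class, the POLYNOMIAL short pairs (one polynomial piece
`p·1_{[0,θ)}` with `p(θ) = 0` per profile — the `K = 1` case of DISPLAY #2 LEMMA A's piecewise-polynomial in-class
profiles), and assembles the three ports:

* Part 1 — `polyPiece θ p`, `polyPieceDeriv θ p`, `PolyShortPiece θ u u′`, `PolyShortPairs`; a polynomial short piece is
  a short in-class piece (`PolyShortPiece.shortPiece`: continuity across the kink from `p(θ) = 0`, right derivatives,
  bounded measurable derivative), `polyShortPairs_shortPairs`.
* Part 2 — **`mainTermForm_le_of_bounds`**: for ANY `w, w′` with `‖w‖ ≤ d` on `[0,1]`, `∫₀¹‖w′‖ ≤ e`, `∫₀¹‖w′‖² ≤ e²`: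
  `𝔅(w,w′) ≤ (8/π)e² + 48de + (88π + 48π² + 48π + 16)d²` — the six terms of `mainTermForm_eq` bounded one by one
  (the `H¹`-boundedness half of (D11″); `𝔅` is a bounded Hermitian form on `L^∞ × L²`, a fortiori on `H¹`).
* Part 3 — **`ShortPiece.exists_polyShortPiece_approx`** / **`exists_polyShortPairs_approx`**: every kinked short piece
  `f` of length `θ ≤ 1` is, for every `η > 0`, within `𝔅`-distance `η` of a polynomial short piece OF THE SAME LENGTH
  (so a short pair stays short): `L²`-approximate `f′` by a continuous `h` (`IsH1OnUnitInterval.exists_continuous_approx`),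
  `h` by a complex polynomial `q` uniformly on `[0,1]` (Weierstrass, `exists_polynomial_near_of_continuousOn` on real and
  imaginary parts), put `p := ∫q − (∫q)(θ)` (`polyAntideriv`, `derivative_polyAntideriv`); then on `[0,θ]`
  `f − p = −∫ₓ^θ (f′ − q)` (`f(θ) = 0`, FTC with right derivatives = `KinkedProfile.isH1`), so
  `sup|f − p·1_{<θ}| ≤ ∫₀¹|f′ − q| ≤ ‖f′ − q‖_{L²}` and Part 2 gives `𝔅 ≤ 1400‖f′ − q‖²_{L²}`.
* Part 4 — THE PORTS (every degree `d`, every sub-class `𝒞₀ ⊇ PolyShortPairs`; K0 and darkness on `𝒞₀` are HYPOTHESES):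
  `crossTablePsiOn_short_zero_of_poly` (dark cross cell of degree `d` on `𝒞₀` + `InClassMean c′` + `Lemma23 c′` ⇒ dark on
  ALL short pairs), `dualCrossTablePsiOn_short_zero_of_poly` (dual twin), `tauTwoDarkShort_of_poly` (`d = 2`:
  `TauTwoDarkShort c′`), and the eventually-in-`c′` packagings `crossTablePsiOn_short_zero_eventually_of_poly`,
  `dualCrossTablePsiOn_short_zero_eventually_of_poly`, `tauTwoDarkShort_eventually_of_poly` (Lemma 2.3 discharged by
  `lemma23_eventually`; K0 in the route's shape `∃ c₀, ∀ c′ ≥ c₀, InClassMean c′` = stmt-Parity-20016; darkness allowed to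
  use K0 at the same `c′`). These are exactly the inputs of the route items stmt-Parity-20429 `ShortPairsTauTwoDark`,
  20444 `ShortPairsCrossDegOne` (with `X₁ := 0`), 20445 `ShortPairsDualDegOne` (`Y₁ := 0`) and of the typed kill path
  `Theorems.shortPairsSchurClose_iff_notAEventually_of_dark` (p531342), MODULO: K0, and darkness of the three cells on
  polynomial short pairs — the desk-derived content of DISPLAYS #3 (K1A-DISPLAY-3-Daudit v1.0a 24fccd0f8afb1eb3, x₂|short,
  theory PASS-WITH-NOTES 10:41:08Z, crit-1 PASS-AS-COUNT) and #4 (K1A-DISPLAY-4-Y1short d9c044f56c100226, x₁|short and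
  y₁|short, theory PASS-WITH-NOTES 11:37:13Z), which stays OPEN in the kernel (Zhang's Prop 7.1 / Lemma 8.1 / Lemma 8.2 /
  Lemma 4.8 run on the data `a₁ = D·(δ_D ⋆ υ ⋆ χg ⋆ χf)`, `a₂ = ν·1_{<D⁴}`; not formalised) and is asserted by no one here.

Typer: ls-knife-toeplitz-typer-1 g0 (literature-prover; cell landau-siegel §D, chain #1 closure squad).

## References
* Y. Zhang, arXiv:2211.02515v1 (2022), §2 Lemma 2.3, (2.15)–(2.17); §7 Prop. 7.1, (7.2) p. 13; §8 (8.5), Lemma 8.1,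
  Lemma 8.2 p. 16, (8.23). [cite: Zhang2022LandauSiegel, §2 Lemma 2.3, §7 Prop 7.1 (7.2) p.13, §8 (8.5) Lemma 8.1 Lemma 8.2 p.16]
* K. Weierstrass (1885) / S. Bernstein (1912): polynomial approximation on a compact interval — Mathlib
  `exists_polynomial_near_of_continuousOn`. [folklore]
-/

noncomputable section

open Complex Real ComplexConjugate MeasureTheory Set Filter intervalIntegral Polynomial
open scoped Topology

namespace Literature.NumberTheory.LFunctions.Zhang2022.KnifeEdge

open Repair Skeleton

/-! ### Part 1 — polynomial short pieces and polynomial short pairs -/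

section Poly

/-- The POLYNOMIAL PIECE of length `θ` with polynomial `p`: `x ↦ p(x)` for `x < θ`, `0` for `x ≥ θ` (a profile on the
logarithmic scale `x = log n/log P`, support `n < P^θ`). [cite: Zhang2022LandauSiegel, §7 (7.2) p.13] -/
def polyPiece (θ : ℝ) (p : ℂ[X]) (x : ℝ) : ℂ := if x < θ then p.eval (x : ℂ) else 0

/-- Its marked (right) derivative: `p′(x)` for `x < θ`, `0` for `x ≥ θ`. [cite: Zhang2022LandauSiegel, §7 (7.2) p.13] -/
def polyPieceDeriv (θ : ℝ) (p : ℂ[X]) (x : ℝ) : ℂ := if x < θ then (derivative p).eval (x : ℂ) else 0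

/-- **A POLYNOMIAL SHORT PIECE of length `θ ≤ 1`**: `u = p·1_{(-∞,θ)}` and `u′ = p′·1_{(-∞,θ)}` for a complex polynomial
`p` with `p(θ) = 0` (continuity across the one kink at `θ`) — the one-piece (`K = 1`) case of the K1″a hand's
piecewise-polynomial in-class profiles (DISPLAY #2 LEMMA A). [cite: Zhang2022LandauSiegel, §7 (7.2) p.13, §8 Lemma 8.2 p.16] -/
structure PolyShortPiece (θ : ℝ) (u u' : ℝ → ℂ) : Prop where
  le_one : θ ≤ 1
  exists_poly : ∃ p : ℂ[X], p.eval (θ : ℂ) = 0 ∧ u = polyPiece θ p ∧ u' = polyPieceDeriv θ p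

/-- **The class of POLYNOMIAL SHORT PAIRS**: pairs of polynomial short pieces of lengths `θ_f + θ_g < 1` — a sub-class of
`ShortPairs` (`polyShortPairs_shortPairs`) which is `𝔅`-dense in it (`exists_polyShortPairs_approx`).
[cite: Zhang2022LandauSiegel, §7 (7.2) p.13, §8 Lemma 8.1 p.16] -/
def PolyShortPairs : PairClass := fun f f' g g' =>
  ∃ θf θg : ℝ, θf + θg < 1 ∧ PolyShortPiece θf f f' ∧ PolyShortPiece θg g g'

variable {θ : ℝ} {p : ℂ[X]}

/-- Unfolding below the kink. [cite: Zhang2022LandauSiegel, §7 (7.2) p.13] -/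
theorem polyPiece_of_lt {x : ℝ} (hx : x < θ) : polyPiece θ p x = p.eval (x : ℂ) := by
  simp [polyPiece, hx]

/-- Unfolding above the kink. [cite: Zhang2022LandauSiegel, §7 (7.2) p.13] -/
theorem polyPiece_of_le {x : ℝ} (hx : θ ≤ x) : polyPiece θ p x = 0 := by
  simp [polyPiece, not_lt.mpr hx]

/-- Unfolding of the derivative below the kink. [cite: Zhang2022LandauSiegel, §7 (7.2) p.13] -/
theorem polyPieceDeriv_of_lt {x : ℝ} (hx : x < θ) : polyPieceDeriv θ p x = (derivative p).eval (x : ℂ) := by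
  simp [polyPieceDeriv, hx]

/-- Unfolding of the derivative above the kink. [cite: Zhang2022LandauSiegel, §7 (7.2) p.13] -/
theorem polyPieceDeriv_of_le {x : ℝ} (hx : θ ≤ x) : polyPieceDeriv θ p x = 0 := by
  simp [polyPieceDeriv, not_lt.mpr hx]

/-- The zero polynomial gives the zero piece. [cite: Zhang2022LandauSiegel, §7 (7.2) p.13] -/
theorem polyPiece_zero (θ : ℝ) : polyPiece θ 0 = fun _ => 0 := by
  funext x
  simp [polyPiece]

/-- The zero polynomial gives the zero derivative piece. [cite: Zhang2022LandauSiegel, §7 (7.2) p.13] -/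
theorem polyPieceDeriv_zero (θ : ℝ) : polyPieceDeriv θ 0 = fun _ => 0 := by
  funext x
  simp [polyPieceDeriv]

/-- The real trace `x ↦ p(x)` of a complex polynomial has real derivative `p′(x)`. [folklore] -/
private theorem hasDerivAt_polyEval_ofReal (p : ℂ[X]) (x : ℝ) :
    HasDerivAt (fun y : ℝ => p.eval (y : ℂ)) ((derivative p).eval (x : ℂ)) x :=
  (p.hasDerivAt (x : ℂ)).comp_ofReal

/-- The real trace `x ↦ p(x)` of a complex polynomial is continuous. [folklore] -/
private theorem continuous_polyEval_ofReal (p : ℂ[X]) : Continuous fun y : ℝ => p.eval (y : ℂ) :=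
  p.continuous.comp continuous_ofReal

/-- A continuous function on `[0,1]` is bounded there (by a nonnegative constant). [folklore] -/
private theorem exists_bound_Icc {F : ℝ → ℂ} (hF : Continuous F) : ∃ C : ℝ, 0 ≤ C ∧ ∀ x ∈ Icc (0:ℝ) 1, ‖F x‖ ≤ C := by
  obtain ⟨C, hC⟩ := isCompact_Icc.exists_bound_of_continuousOn hF.continuousOn
  exact ⟨max C 0, le_max_right _ _, fun x hx => (hC x hx).trans (le_max_left _ _)⟩

/-- A polynomial piece is continuous (the value `p(θ) = 0` glues the kink). [cite: Zhang2022LandauSiegel, §7 (7.2) p.13] -/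
theorem continuous_polyPiece (hp : p.eval (θ : ℂ) = 0) : Continuous (polyPiece θ p) := by
  have e : polyPiece θ p = fun x => if θ ≤ x then (0 : ℂ) else p.eval (x : ℂ) := by
    funext x
    by_cases hx : θ ≤ x
    · simp [polyPiece, hx, not_lt.mpr hx]
    · simp [polyPiece, hx, not_le.mp hx]
  rw [e]
  exact Continuous.if_le continuous_const (continuous_polyEval_ofReal p) continuous_const continuous_id
    fun x hx => by rw [← hx, hp]

/-- The derivative piece is measurable. [folklore] -/
private theorem measurable_polyPieceDeriv (θ : ℝ) (p : ℂ[X]) : Measurable (polyPieceDeriv θ p) := by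
  unfold polyPieceDeriv
  exact Measurable.ite measurableSet_Iio (continuous_polyEval_ofReal _).measurable measurable_const

/-- The derivative piece is bounded on `[0,1]`. [folklore] -/
private theorem exists_bound_polyPieceDeriv (θ : ℝ) (p : ℂ[X]) :
    ∃ C : ℝ, 0 ≤ C ∧ ∀ x ∈ Icc (0:ℝ) 1, ‖polyPieceDeriv θ p x‖ ≤ C := by
  obtain ⟨C, hC0, hC⟩ := exists_bound_Icc (continuous_polyEval_ofReal (derivative p))
  refine ⟨C, hC0, fun x hx => ?_⟩
  by_cases h : x < θ
  · rw [polyPieceDeriv_of_lt h]; exact hC x hx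
  · rw [polyPieceDeriv_of_le (not_lt.mp h), norm_zero]; exact hC0

/-- The derivative piece is in `L²(0,1]`. [folklore] -/
private theorem memLp_polyPieceDeriv (θ : ℝ) (p : ℂ[X]) :
    MemLp (polyPieceDeriv θ p) 2 (volume.restrict (Ioc (0:ℝ) 1)) := by
  obtain ⟨C, -, hC⟩ := exists_bound_polyPieceDeriv θ p
  exact MemLp.of_bound (measurable_polyPieceDeriv θ p).aestronglyMeasurable C
    ((ae_restrict_iff' measurableSet_Ioc).2 (ae_of_all _ fun x hx => hC x (Ioc_subset_Icc_self hx)))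

/-- The derivative piece is interval integrable on `[0,1]`. [folklore] -/
private theorem intervalIntegrable_polyPieceDeriv (θ : ℝ) (p : ℂ[X]) : IntervalIntegrable (polyPieceDeriv θ p) volume 0 1 := by
  rw [intervalIntegrable_iff, uIoc_of_le zero_le_one]
  exact (memLp_polyPieceDeriv θ p).integrable one_le_two

/-- A polynomial piece has the derivative piece as RIGHT derivative at every point. [cite: Zhang2022LandauSiegel, §7 (7.2) p.13] -/
theorem hasDerivWithinAt_polyPiece (x : ℝ) :
    HasDerivWithinAt (polyPiece θ p) (polyPieceDeriv θ p x) (Ioi x) x := by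
  by_cases hx : x < θ
  · -- below the kink the piece agrees with the polynomial near `x`
    rw [polyPieceDeriv_of_lt hx]
    have hev : polyPiece θ p =ᶠ[𝓝 x] fun y : ℝ => p.eval (y : ℂ) :=
      (eventually_of_mem (Iio_mem_nhds hx) fun y hy => polyPiece_of_lt hy)
    exact ((hasDerivAt_polyEval_ofReal p x).congr_of_eventuallyEq hev).hasDerivWithinAt
  · -- at and above the kink the piece vanishes on `[x, ∞)`
    have hx' : θ ≤ x := not_lt.mp hx
    rw [polyPieceDeriv_of_le hx']
    refine (hasDerivWithinAt_const x (Ioi x) (0 : ℂ)).congr_of_eventuallyEq ?_ ?_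
    · exact eventually_nhdsWithin_of_forall fun y hy => polyPiece_of_le (hx'.trans (le_of_lt hy))
    · simp [polyPiece, not_lt.mpr hx']

/-- **A polynomial short piece is a short in-class piece** (kinked `H¹` profile vanishing with its derivative on
`[θ, ∞) ⊇ [1, ∞)`). [cite: Zhang2022LandauSiegel, §7 (7.2) p.13] -/
theorem PolyShortPiece.shortPiece {u u' : ℝ → ℂ} (h : PolyShortPiece θ u u') : ShortPiece θ u u' := by
  obtain ⟨p, hp, rfl, rfl⟩ := h.exists_poly
  have hθ := h.le_one
  refine ⟨⟨⟨(continuous_polyPiece hp).continuousOn, fun x _ => hasDerivWithinAt_polyPiece x,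
    memLp_polyPieceDeriv θ p⟩, fun y hy => polyPiece_of_le (hθ.trans hy), fun y hy => polyPieceDeriv_of_le (hθ.trans hy)⟩,
    fun y hy => polyPiece_of_le hy, fun y hy => polyPieceDeriv_of_le hy⟩

/-- A polynomial short piece is an in-class piece. [cite: Zhang2022LandauSiegel, §7 (7.2) p.13] -/
theorem PolyShortPiece.inClassPiece {u u' : ℝ → ℂ} (h : PolyShortPiece θ u u') : InClassPiece u u' :=
  h.shortPiece.inClass

/-- The zero profile is a polynomial short piece of every length `θ ≤ 1` (polynomial `0`).
[cite: Zhang2022LandauSiegel, §7 (7.2) p.13] -/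
theorem polyShortPiece_zero (hθ : θ ≤ 1) : PolyShortPiece θ (fun _ => 0) (fun _ => 0) :=
  ⟨hθ, 0, by simp, (polyPiece_zero θ).symm, (polyPieceDeriv_zero θ).symm⟩

/-- **Polynomial short pairs are short pairs.** [cite: Zhang2022LandauSiegel, §7 (7.2) p.13] -/
theorem polyShortPairs_shortPairs {f f' g g' : ℝ → ℂ} (h : PolyShortPairs f f' g g') : ShortPairs f f' g g' := by
  obtain ⟨θf, θg, hs, hf, hg⟩ := h
  exact ⟨θf, θg, hs, hf.shortPiece, hg.shortPiece⟩

/-- A short piece of length `θ` is short of length `min θ 1` (in-class pieces vanish on `[1,∞)` anyway).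
[cite: Zhang2022LandauSiegel, §7 (7.2) p.13] -/
theorem ShortPiece.min_one {u u' : ℝ → ℂ} (h : ShortPiece θ u u') : ShortPiece (min θ 1) u u' where
  inClass := h.inClass
  vanish := fun y hy => by
    rcases le_total θ 1 with h1 | h1
    · exact h.vanish y (by rw [min_eq_left h1] at hy; exact hy)
    · exact h.inClass.vanish y (by rw [min_eq_right h1] at hy; exact hy)
  vanish' := fun y hy => by
    rcases le_total θ 1 with h1 | h1
    · exact h.vanish' y (by rw [min_eq_left h1] at hy; exact hy)
    · exact h.inClass.vanish' y (by rw [min_eq_right h1] at hy; exact hy)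

/-! #### A polynomial antiderivative -/

/-- A polynomial antiderivative: `Σ aₙXⁿ ↦ Σ aₙ/(n+1)·Xⁿ⁺¹`. [folklore] -/
private def polyAntideriv (q : ℂ[X]) : ℂ[X] := q.sum fun n a => C (a / ((n : ℂ) + 1)) * X ^ (n + 1)

/-- `(polyAntideriv q)′ = q`. [folklore] -/
private theorem derivative_polyAntideriv (q : ℂ[X]) : derivative (polyAntideriv q) = q := by
  rw [polyAntideriv, Polynomial.sum_def, derivative_sum]
  conv_rhs => rw [q.as_sum_support_C_mul_X_pow]
  refine Finset.sum_congr rfl fun n _ => ?_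
  rw [derivative_C_mul_X_pow]
  have hn : ((n : ℂ) + 1) ≠ 0 := Nat.cast_add_one_ne_zero n
  have hc : q.coeff n / ((n : ℂ) + 1) * ((n + 1 : ℕ) : ℂ) = q.coeff n := by
    push_cast
    field_simp
  rw [hc, Nat.add_sub_cancel]

end Poly

/-! ### Part 2 — `𝔅` is bounded by the sup-norm of the profile and the `L¹`/`L²` size of its derivative -/

section Bound

/-- **`𝔅(w,w′) ≤ (8/π)e² + 48de + (88π + 48π² + 48π + 16)d²`** whenever `‖w‖ ≤ d` on `[0,1]`, `∫₀¹‖w′‖ ≤ e` and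
`∫₀¹‖w′‖² ≤ e²` — the six terms of the glued main-term form `mainTermForm_eq` bounded one by one
(`(8/π)‖w′‖²₂`; `48|Im⟨w′,w⟩| ≤ 48de`; `88π‖w‖²₂ ≤ 88πd²`; `48π²|Im⟨w,S_w⟩| ≤ 48π²d²` with `|S_w| ≤ d`;
`24π|Re(S̄_w(1)(w(0)+w(1)))| ≤ 48πd²`; `16|Im(w(0)w̄(1))| ≤ 16d²`). The `H¹`-boundedness of `𝔅` used by the K1″a hand's
density step (DISPLAY #2 §E (3): «`𝔅(w) ≤ C_𝔅‖w‖²_{H¹}`»); `𝔅` = the manuscript's glued main-term form of Prop 7.1 /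
(8.23) (`mainTermForm_eq`). [cite: Zhang2022LandauSiegel, §7 Prop 7.1 p.13, §8 (8.23) p.16] -/
theorem mainTermForm_le_of_bounds {w w' : ℝ → ℂ} {d e : ℝ} (hd : 0 ≤ d)
    (hw : ∀ x ∈ Icc (0:ℝ) 1, ‖w x‖ ≤ d) (hw'i : IntervalIntegrable w' volume 0 1)
    (h1 : ∫ x in (0:ℝ)..1, ‖w' x‖ ≤ e) (h2 : ∫ x in (0:ℝ)..1, ‖w' x‖ ^ 2 ≤ e ^ 2) :
    mainTermForm w w' ≤ 8 / π * e ^ 2 + 48 * (d * e) + (88 * π + 48 * π ^ 2 + 48 * π + 16) * d ^ 2 := by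
  have h0 : (0:ℝ) ∈ Icc (0:ℝ) 1 := left_mem_Icc.2 zero_le_one
  have h1m : (1:ℝ) ∈ Icc (0:ℝ) 1 := right_mem_Icc.2 zero_le_one
  -- the primitive `S_w(x) = ∫₀ˣ w` is bounded by `d` on `[0,1]`
  have hS : ∀ x ∈ Icc (0:ℝ) 1, ‖∫ t in (0:ℝ)..x, w t‖ ≤ d := fun x hx => norm_integral_le_of_le_unit hd hw hx
  -- term 1
  have T1 : 8 / π * (∫ x in (0:ℝ)..1, ‖w' x‖ ^ 2) ≤ 8 / π * e ^ 2 :=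
    mul_le_mul_of_nonneg_left h2 (by positivity)
  -- term 2
  have T2 : 48 * (∫ x in (0:ℝ)..1, w' x * conj (w x)).im ≤ 48 * (d * e) := by
    refine mul_le_mul_of_nonneg_left ?_ (by norm_num)
    have hb : ‖∫ x in (0:ℝ)..1, w' x * conj (w x)‖ ≤ ∫ x in (0:ℝ)..1, d * ‖w' x‖ :=
      intervalIntegral.norm_integral_le_of_norm_le zero_le_one
        (ae_of_all _ fun t ht => by
          rw [norm_mul, Complex.norm_conj, mul_comm]
          exact mul_le_mul_of_nonneg_right (hw t (Ioc_subset_Icc_self ht)) (norm_nonneg _))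
        (hw'i.norm.const_mul d)
    rw [intervalIntegral.integral_const_mul] at hb
    calc (∫ x in (0:ℝ)..1, w' x * conj (w x)).im ≤ |(∫ x in (0:ℝ)..1, w' x * conj (w x)).im| := le_abs_self _
      _ ≤ ‖∫ x in (0:ℝ)..1, w' x * conj (w x)‖ := Complex.abs_im_le_norm _
      _ ≤ d * ∫ x in (0:ℝ)..1, ‖w' x‖ := hb
      _ ≤ d * e := mul_le_mul_of_nonneg_left h1 hd
  -- term 3
  have T3 : 88 * π * (∫ x in (0:ℝ)..1, ‖w x‖ ^ 2) ≤ 88 * π * d ^ 2 := by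
    refine mul_le_mul_of_nonneg_left ?_ (by positivity)
    have hb : ‖∫ x in (0:ℝ)..1, ((‖w x‖ ^ 2 : ℝ) : ℝ)‖ ≤ ∫ x in (0:ℝ)..1, d ^ 2 :=
      intervalIntegral.norm_integral_le_of_norm_le zero_le_one
        (ae_of_all _ fun t ht => by
          rw [Real.norm_of_nonneg (sq_nonneg _)]
          exact pow_le_pow_left₀ (norm_nonneg _) (hw t (Ioc_subset_Icc_self ht)) 2)
        intervalIntegrable_const
    rw [intervalIntegral.integral_const, sub_zero, smul_eq_mul, one_mul] at hb
    exact (Real.le_norm_self _).trans hb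
  -- term 4
  have T4 : 48 * π ^ 2 * (∫ x in (0:ℝ)..1, w x * conj (∫ t in (0:ℝ)..x, w t)).im ≤ 48 * π ^ 2 * d ^ 2 := by
    refine mul_le_mul_of_nonneg_left ?_ (by positivity)
    have hb : ‖∫ x in (0:ℝ)..1, w x * conj (∫ t in (0:ℝ)..x, w t)‖ ≤ ∫ x in (0:ℝ)..1, d * d :=
      intervalIntegral.norm_integral_le_of_norm_le zero_le_one
        (ae_of_all _ fun t ht => by
          rw [norm_mul, Complex.norm_conj]
          exact mul_le_mul (hw t (Ioc_subset_Icc_self ht)) (hS t (Ioc_subset_Icc_self ht)) (norm_nonneg _) hd)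
        intervalIntegrable_const
    rw [intervalIntegral.integral_const, sub_zero, smul_eq_mul, one_mul] at hb
    calc (∫ x in (0:ℝ)..1, w x * conj (∫ t in (0:ℝ)..x, w t)).im
        ≤ |(∫ x in (0:ℝ)..1, w x * conj (∫ t in (0:ℝ)..x, w t)).im| := le_abs_self _
      _ ≤ ‖∫ x in (0:ℝ)..1, w x * conj (∫ t in (0:ℝ)..x, w t)‖ := Complex.abs_im_le_norm _
      _ ≤ d * d := hb
      _ = d ^ 2 := by ring
  -- term 5
  have T5 : -(24 * π * (conj (∫ t in (0:ℝ)..1, w t) * (w 0 + w 1)).re) ≤ 48 * π * d ^ 2 := by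
    have hb : ‖conj (∫ t in (0:ℝ)..1, w t) * (w 0 + w 1)‖ ≤ d * (d + d) := by
      rw [norm_mul, Complex.norm_conj]
      exact mul_le_mul (hS 1 h1m) ((norm_add_le _ _).trans (add_le_add (hw 0 h0) (hw 1 h1m))) (norm_nonneg _) hd
    have hre : -(conj (∫ t in (0:ℝ)..1, w t) * (w 0 + w 1)).re ≤ d * (d + d) :=
      (neg_le_abs _).trans ((Complex.abs_re_le_norm _).trans hb)
    have hπ : 0 ≤ 24 * π := by positivity
    calc -(24 * π * (conj (∫ t in (0:ℝ)..1, w t) * (w 0 + w 1)).re)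
        = 24 * π * (-(conj (∫ t in (0:ℝ)..1, w t) * (w 0 + w 1)).re) := by ring
      _ ≤ 24 * π * (d * (d + d)) := mul_le_mul_of_nonneg_left hre hπ
      _ = 48 * π * d ^ 2 := by ring
  -- term 6
  have T6 : 16 * (w 0 * conj (w 1)).im ≤ 16 * d ^ 2 := by
    refine mul_le_mul_of_nonneg_left ?_ (by norm_num)
    calc (w 0 * conj (w 1)).im ≤ |(w 0 * conj (w 1)).im| := le_abs_self _
      _ ≤ ‖w 0 * conj (w 1)‖ := Complex.abs_im_le_norm _
      _ ≤ d * d := by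
          rw [norm_mul, Complex.norm_conj]
          exact mul_le_mul (hw 0 h0) (hw 1 h1m) (norm_nonneg _) hd
      _ = d ^ 2 := by ring
  rw [mainTermForm_eq]
  linarith

/-- Numerical form of the constant: `8/π + 48 + 88π + 48π² + 48π + 16 ≤ 1400` (`3 < π < 4`). [folklore] -/
private theorem mainTermForm_bound_const_le : 8 / π + 48 + (88 * π + 48 * π ^ 2 + 48 * π + 16) ≤ 1400 := by
  have h3 := Real.pi_gt_three
  have h4 := Real.pi_lt_four
  have hdiv : 8 / π ≤ 3 := by
    rw [div_le_iff₀ Real.pi_pos]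
    linarith
  nlinarith

/-- **Corollary (one scale):** `‖w‖ ≤ e` on `[0,1]`, `∫₀¹‖w′‖ ≤ e`, `∫₀¹‖w′‖² ≤ e²` ⇒ `𝔅(w,w′) ≤ 1400e²`.
[cite: Zhang2022LandauSiegel, §7 Prop 7.1 p.13, §8 (8.23) p.16] -/
theorem mainTermForm_le_of_bounds' {w w' : ℝ → ℂ} {e : ℝ} (he : 0 ≤ e)
    (hw : ∀ x ∈ Icc (0:ℝ) 1, ‖w x‖ ≤ e) (hw'i : IntervalIntegrable w' volume 0 1)
    (h1 : ∫ x in (0:ℝ)..1, ‖w' x‖ ≤ e) (h2 : ∫ x in (0:ℝ)..1, ‖w' x‖ ^ 2 ≤ e ^ 2) :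
    mainTermForm w w' ≤ 1400 * e ^ 2 := by
  have h := mainTermForm_le_of_bounds he hw hw'i h1 h2
  have hc := mainTermForm_bound_const_le
  have he2 : 0 ≤ e ^ 2 := sq_nonneg e
  calc mainTermForm w w' ≤ 8 / π * e ^ 2 + 48 * (e * e) + (88 * π + 48 * π ^ 2 + 48 * π + 16) * e ^ 2 := h
    _ = (8 / π + 48 + (88 * π + 48 * π ^ 2 + 48 * π + 16)) * e ^ 2 := by ring
    _ ≤ 1400 * e ^ 2 := mul_le_mul_of_nonneg_right hc he2

end Bound

/-! ### Part 3 — DENSITY: every kinked short piece is `𝔅`-close to a polynomial short piece of the same length -/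

section Density

variable {θ : ℝ} {f f' : ℝ → ℂ}

/-- Weierstrass for a complex-valued continuous function on `[0,1]`: a complex polynomial uniformly `ε`-close.
[folklore] -/
private theorem exists_poly_near_of_continuous {h : ℝ → ℂ} (hh : Continuous h) {ε : ℝ} (hε : 0 < ε) :
    ∃ q : ℂ[X], ∀ x ∈ Icc (0:ℝ) 1, ‖q.eval (x : ℂ) - h x‖ ≤ ε := by
  obtain ⟨q₁, hq₁⟩ := exists_polynomial_near_of_continuousOn 0 1 (fun x => (h x).re)
    (Complex.continuous_re.comp hh).continuousOn (ε / 2) (by positivity)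
  obtain ⟨q₂, hq₂⟩ := exists_polynomial_near_of_continuousOn 0 1 (fun x => (h x).im)
    (Complex.continuous_im.comp hh).continuousOn (ε / 2) (by positivity)
  refine ⟨q₁.map Complex.ofRealHom + C I * q₂.map Complex.ofRealHom, fun x hx => ?_⟩
  have e1 : (q₁.map Complex.ofRealHom).eval (x : ℂ) = ((q₁.eval x : ℝ) : ℂ) := by
    rw [eval_map, ← Complex.ofRealHom_eq_coe, eval₂_at_apply, Complex.ofRealHom_eq_coe]
  have e2 : (q₂.map Complex.ofRealHom).eval (x : ℂ) = ((q₂.eval x : ℝ) : ℂ) := by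
    rw [eval_map, ← Complex.ofRealHom_eq_coe, eval₂_at_apply, Complex.ofRealHom_eq_coe]
  have hdecomp : (q₁.map Complex.ofRealHom + C I * q₂.map Complex.ofRealHom).eval (x : ℂ) - h x
      = ((q₁.eval x - (h x).re : ℝ) : ℂ) + ((q₂.eval x - (h x).im : ℝ) : ℂ) * I := by
    rw [eval_add, eval_mul, eval_C, e1, e2]
    conv_lhs => rw [← Complex.re_add_im (h x)]
    push_cast
    ring
  rw [hdecomp]
  calc ‖((q₁.eval x - (h x).re : ℝ) : ℂ) + ((q₂.eval x - (h x).im : ℝ) : ℂ) * I‖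
      ≤ ‖((q₁.eval x - (h x).re : ℝ) : ℂ)‖ + ‖((q₂.eval x - (h x).im : ℝ) : ℂ) * I‖ := norm_add_le _ _
    _ = |q₁.eval x - (h x).re| + |q₂.eval x - (h x).im| := by
        rw [norm_mul, Complex.norm_I, mul_one, Complex.norm_real, Complex.norm_real, Real.norm_eq_abs,
          Real.norm_eq_abs]
    _ ≤ ε / 2 + ε / 2 := add_le_add (hq₁ x hx).le (hq₂ x hx).le
    _ = ε := by ring

/-- The zero piece case: for `θ ≤ 0` a short piece vanishes on `[0, ∞)` and is `𝔅`-equal to the zero polynomial piece.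
[cite: Zhang2022LandauSiegel, §7 (7.2) p.13] -/
private theorem exists_polyShortPiece_approx_of_nonpos (hf : ShortPiece θ f f') (hθ : θ ≤ 0) {η : ℝ} (hη : 0 < η) :
    ∃ fN fN' : ℝ → ℂ, PolyShortPiece θ fN fN' ∧
      mainTermForm (fun x => f x - fN x) (fun x => f' x - fN' x) ≤ η := by
  refine ⟨fun _ => 0, fun _ => 0, polyShortPiece_zero (hθ.trans zero_le_one), ?_⟩
  have hw : ∀ x ∈ Icc (0:ℝ) 1, ‖f x - 0‖ ≤ 0 := fun x hx => by
    rw [sub_zero, hf.vanish x (hθ.trans hx.1), norm_zero]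
  have hw' : ∀ x ∈ uIcc (0:ℝ) 1, f' x - 0 = 0 := fun x hx => by
    rw [uIcc_of_le zero_le_one] at hx
    rw [sub_zero, hf.vanish' x (hθ.trans hx.1)]
  have hi : IntervalIntegrable (fun x => f' x - 0) volume 0 1 := by
    simpa using hf.inClass.kinked.isH1.intervalIntegrable
  have h1 : ∫ x in (0:ℝ)..1, ‖f' x - 0‖ ≤ 0 := by
    rw [intervalIntegral.integral_congr (g := fun _ => (0:ℝ)) fun x hx => by simp [hw' x hx]]
    simp
  have h2 : ∫ x in (0:ℝ)..1, ‖f' x - 0‖ ^ 2 ≤ 0 ^ 2 := by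
    rw [intervalIntegral.integral_congr (g := fun _ => (0:ℝ)) fun x hx => by simp [hw' x hx]]
    simp
  have := mainTermForm_le_of_bounds' le_rfl hw hi h1 h2
  linarith

/-- **DENSITY OF POLYNOMIAL SHORT PIECES (one profile).** A kinked short piece `f` of length `θ ≤ 1` is, for every
`η > 0`, within `𝔅`-distance `η` of a polynomial short piece of the SAME length `θ`: `𝔅(f − f_N, f′ − f_N′) ≤ η`.
Proof (DISPLAY #2 §E (1)+(3), made quantitative): `f′ ∈ L²` is `L²`-close to a continuous `h`, `h` is uniformly close
to a polynomial `q` on `[0,1]` (Weierstrass on `Re h`, `Im h`); with `p = ∫q − (∫q)(θ)` one has `p(θ) = 0`, `p′ = q`,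
and on `[0,θ]` `f − p = −∫ₓ^θ (f′ − q)` because `f(θ) = 0` and `f` is the integral of its right derivative
(`KinkedProfile.isH1`); hence `sup|w| ≤ ∫₀¹|f′−q| ≤ ‖f′−q‖₂`, `‖w′‖₂ ≤ ‖f′−q‖₂`, and Part 2 gives
`𝔅(w) ≤ 1400‖f′−q‖₂²`. [cite: Zhang2022LandauSiegel, §7 (7.2) p.13, §8 Lemma 8.2 p.16] -/
theorem ShortPiece.exists_polyShortPiece_approx (hf : ShortPiece θ f f') (hθ1 : θ ≤ 1) {η : ℝ} (hη : 0 < η) :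
    ∃ fN fN' : ℝ → ℂ, PolyShortPiece θ fN fN' ∧
      mainTermForm (fun x => f x - fN x) (fun x => f' x - fN' x) ≤ η := by
  rcases le_or_gt θ 0 with hθ0 | hθ0
  · exact exists_polyShortPiece_approx_of_nonpos hf hθ0 hη
  -- `0 < θ ≤ 1`
  have hK : KinkedProfile f f' := hf.inClass.kinked
  have hH : IsH1OnUnitInterval f f' := hK.isH1
  have hf'i : IntervalIntegrable f' volume 0 1 := hH.intervalIntegrable
  have hθI : θ ∈ Icc (0:ℝ) 1 := ⟨hθ0.le, hθ1⟩
  -- target size for `‖f′ − q‖₂²`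
  set e₀ : ℝ := η / 1400 with he₀
  have he₀0 : 0 < e₀ := by positivity
  -- continuous `h` with `‖h − f′‖₂² ≤ e₀/4`
  obtain ⟨h, hc, hm, hhe⟩ := hH.exists_continuous_approx (ε := e₀ / 4) (by positivity)
  -- polynomial `q` with `‖q − h‖ ≤ ε₂` on `[0,1]`, `4ε₂² ≤ e₀/4`
  set ε₂ : ℝ := min 1 (e₀ / 16) with hε₂
  have hε₂0 : 0 < ε₂ := lt_min zero_lt_one (by positivity)
  have hε₂1 : ε₂ ≤ 1 := min_le_left _ _
  have hε₂e : ε₂ ≤ e₀ / 16 := min_le_right _ _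
  obtain ⟨q, hq⟩ := exists_poly_near_of_continuous hc hε₂0
  -- the polynomial trace `Q` and its antiderivative `A`
  set Q : ℝ → ℂ := fun x => q.eval (x : ℂ) with hQ
  have hQc : Continuous Q := continuous_polyEval_ofReal q
  set A : ℂ[X] := polyAntideriv q with hA
  set p : ℂ[X] := A - C (A.eval (θ : ℂ)) with hp
  have hpθ : p.eval (θ : ℂ) = 0 := by simp [hp]
  have hdp : derivative p = q := by
    rw [hp, derivative_sub, derivative_C, sub_zero, hA, derivative_polyAntideriv]
  have hpev : ∀ x : ℝ, p.eval (x : ℂ) = A.eval (x : ℂ) - A.eval (θ : ℂ) := fun x => by simp [hp]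
  -- FTC for the polynomial: `∫ₓ^θ Q = A(θ) − A(x)`
  have hAderiv : ∀ x : ℝ, HasDerivAt (fun y : ℝ => A.eval (y : ℂ)) (Q x) x := fun x => by
    have h1 := hasDerivAt_polyEval_ofReal (polyAntideriv q) x
    rw [derivative_polyAntideriv] at h1
    simpa only [hA, hQ] using h1
  have hFTCQ : ∀ x : ℝ, ∫ t in x..θ, Q t = A.eval (θ : ℂ) - A.eval (x : ℂ) := fun x =>
    intervalIntegral.integral_eq_sub_of_hasDerivAt (fun t _ => hAderiv t) (hQc.intervalIntegrable _ _)
  -- the approximant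
  set fN : ℝ → ℂ := polyPiece θ p with hfN
  set fN' : ℝ → ℂ := polyPieceDeriv θ p with hfN'
  have hPoly : PolyShortPiece θ fN fN' := ⟨hθ1, p, hpθ, rfl, rfl⟩
  refine ⟨fN, fN', hPoly, ?_⟩
  -- sizes: `E2 = ‖f′ − Q‖₂² ≤ e₀`, `e = √E2`
  have hQmem : MemLp Q 2 (volume.restrict (Ioc (0:ℝ) 1)) := by
    obtain ⟨C, -, hC⟩ := exists_bound_Icc hQc
    exact MemLp.of_bound hQc.measurable.aestronglyMeasurable C
      ((ae_restrict_iff' measurableSet_Ioc).2 (ae_of_all _ fun x hx => hC x (Ioc_subset_Icc_self hx)))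
  have hdm : MemLp (fun x => f' x - Q x) 2 (volume.restrict (Ioc (0:ℝ) 1)) := hK.memLp.sub hQmem
  have hdi : IntervalIntegrable (fun x => f' x - Q x) volume 0 1 := hf'i.sub (hQc.intervalIntegrable _ _)
  have hd2i : IntervalIntegrable (fun x => ‖f' x - Q x‖ ^ 2) volume 0 1 := by
    rw [intervalIntegrable_iff, uIoc_of_le zero_le_one]
    exact (memLp_two_iff_integrable_sq_norm hdm.1).1 hdm
  set E2 : ℝ := ∫ x in (0:ℝ)..1, ‖f' x - Q x‖ ^ 2 with hE2
  have hE2_0 : 0 ≤ E2 := intervalIntegral.integral_nonneg zero_le_one fun x _ => sq_nonneg _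
  -- `E2 ≤ e₀`
  have hhm2 : MemLp (fun x => h x - f' x) 2 (volume.restrict (Ioc (0:ℝ) 1)) := hm.sub hK.memLp
  have hh2i : IntervalIntegrable (fun x => ‖h x - f' x‖ ^ 2) volume 0 1 := by
    rw [intervalIntegrable_iff, uIoc_of_le zero_le_one]
    exact (memLp_two_iff_integrable_sq_norm hhm2.1).1 hhm2
  have hE2le : E2 ≤ e₀ := by
    have hpt : ∀ x ∈ Icc (0:ℝ) 1, ‖f' x - Q x‖ ^ 2 ≤ 2 * ‖h x - f' x‖ ^ 2 + 2 * ε₂ ^ 2 := by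
      intro x hx
      have hqx : ‖Q x - h x‖ ≤ ε₂ := hq x hx
      have htri : ‖f' x - Q x‖ ≤ ‖h x - f' x‖ + ‖Q x - h x‖ := by
        calc ‖f' x - Q x‖ = ‖(h x - f' x) + (Q x - h x)‖ := by
              rw [← norm_neg]; congr 1; ring
          _ ≤ ‖h x - f' x‖ + ‖Q x - h x‖ := norm_add_le _ _
      have hsq1 : ‖f' x - Q x‖ ^ 2 ≤ (‖h x - f' x‖ + ‖Q x - h x‖) ^ 2 :=
        pow_le_pow_left₀ (norm_nonneg _) htri 2
      have hsq2 : ‖Q x - h x‖ ^ 2 ≤ ε₂ ^ 2 := pow_le_pow_left₀ (norm_nonneg _) hqx 2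
      nlinarith [hsq1, hsq2, sq_nonneg (‖h x - f' x‖ - ‖Q x - h x‖)]
    have i1 : IntervalIntegrable (fun x => 2 * ‖h x - f' x‖ ^ 2 + 2 * ε₂ ^ 2) volume 0 1 :=
      (hh2i.const_mul 2).add intervalIntegrable_const
    calc E2 ≤ ∫ x in (0:ℝ)..1, (2 * ‖h x - f' x‖ ^ 2 + 2 * ε₂ ^ 2) :=
          intervalIntegral.integral_mono_on zero_le_one hd2i i1 hpt
      _ = 2 * (∫ x in (0:ℝ)..1, ‖h x - f' x‖ ^ 2) + 2 * ε₂ ^ 2 := by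
          rw [intervalIntegral.integral_add (hh2i.const_mul 2) intervalIntegrable_const,
            intervalIntegral.integral_const_mul, intervalIntegral.integral_const]
          simp
      _ ≤ 2 * (e₀ / 4) + 2 * (ε₂ * 1) := by
          have : ε₂ ^ 2 = ε₂ * ε₂ := sq ε₂
          nlinarith [hhe, hε₂1, hε₂0.le]
      _ ≤ e₀ := by nlinarith [hε₂e]
  set e : ℝ := Real.sqrt E2 with he
  have he0 : 0 ≤ e := Real.sqrt_nonneg _
  have hesq : e ^ 2 = E2 := Real.sq_sqrt hE2_0
  -- `∫₀¹ ‖f′ − Q‖ ≤ e` (Jensen)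
  have hL1 : ∫ x in (0:ℝ)..1, ‖f' x - Q x‖ ≤ e := by
    have hnn : 0 ≤ ∫ x in (0:ℝ)..1, ‖f' x - Q x‖ :=
      intervalIntegral.integral_nonneg zero_le_one fun x _ => norm_nonneg _
    rw [he, Real.le_sqrt hnn hE2_0]
    exact sq_integral_norm_le_unit hdi hd2i
  -- pointwise description of `w = f − fN` and `w′ = f′ − fN′`
  have hfθ : f θ = 0 := hf.vanish θ le_rfl
  have hf_eq : ∀ y ∈ Icc (0:ℝ) θ, f y = -∫ t in y..θ, f' t := by
    intro y hy
    have hy1 : y ∈ Icc (0:ℝ) 1 := ⟨hy.1, hy.2.trans hθ1⟩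
    have e1 := hH.eq_add_integral y hy1
    have e2 := hH.eq_add_integral θ hθI
    rw [hfθ] at e2
    have hi0θ : IntervalIntegrable f' volume 0 θ := intervalIntegrable_mono_unit hf'i hθI
    have hi0y : IntervalIntegrable f' volume 0 y := intervalIntegrable_mono_unit hf'i hy1
    rw [← intervalIntegral.integral_interval_sub_left hi0θ hi0y]
    linear_combination e1 + e2 - e2 - e2
  have hfN_eq : ∀ y, y < θ → fN y = -∫ t in y..θ, Q t := by
    intro y hy
    rw [hfN, polyPiece_of_lt hy, hpev, hFTCQ]
    ring
  have hw_bound : ∀ y ∈ Icc (0:ℝ) 1, ‖f y - fN y‖ ≤ e := by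
    intro y hy
    by_cases hyθ : y < θ
    · have hi_yθ_f : IntervalIntegrable f' volume y θ :=
        (intervalIntegrable_mono_unit hf'i hy).symm.trans (intervalIntegrable_mono_unit hf'i hθI)
      have hi_yθ_Q : IntervalIntegrable Q volume y θ := hQc.intervalIntegrable _ _
      rw [hf_eq y ⟨hy.1, hyθ.le⟩, hfN_eq y hyθ, neg_sub_neg, ← intervalIntegral.integral_sub hi_yθ_Q hi_yθ_f]
      calc ‖∫ t in y..θ, (Q t - f' t)‖ ≤ ∫ t in y..θ, ‖Q t - f' t‖ :=
            intervalIntegral.norm_integral_le_integral_norm hyθ.le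
        _ = ∫ t in y..θ, ‖f' t - Q t‖ := by simp_rw [norm_sub_rev]
        _ ≤ ∫ t in (0:ℝ)..1, ‖f' t - Q t‖ :=
            intervalIntegral.integral_mono_interval hy.1 hyθ.le hθ1
              (Eventually.of_forall fun _ => norm_nonneg _) hdi.norm
        _ ≤ e := hL1
    · have hyθ' : θ ≤ y := not_lt.mp hyθ
      rw [hf.vanish y hyθ', hfN, polyPiece_of_le hyθ', sub_zero, norm_zero]
      exact he0
  have hw'_pt : ∀ x, ‖f' x - fN' x‖ ≤ ‖f' x - Q x‖ := by
    intro x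
    by_cases hx : x < θ
    · rw [hfN', polyPieceDeriv_of_lt hx, hdp]
    · have hx' : θ ≤ x := not_lt.mp hx
      rw [hf.vanish' x hx', hfN', polyPieceDeriv_of_le hx', sub_zero, norm_zero]
      exact norm_nonneg _
  have hw'i : IntervalIntegrable (fun x => f' x - fN' x) volume 0 1 :=
    hf'i.sub (intervalIntegrable_polyPieceDeriv θ p)
  have hw'1 : ∫ x in (0:ℝ)..1, ‖f' x - fN' x‖ ≤ e := by
    have hb : ‖∫ x in (0:ℝ)..1, (‖f' x - fN' x‖ : ℝ)‖ ≤ ∫ x in (0:ℝ)..1, ‖f' x - Q x‖ :=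
      intervalIntegral.norm_integral_le_of_norm_le zero_le_one
        (ae_of_all _ fun t _ => by rw [Real.norm_of_nonneg (norm_nonneg _)]; exact hw'_pt t) hdi.norm
    exact ((Real.le_norm_self _).trans hb).trans hL1
  have hw'2 : ∫ x in (0:ℝ)..1, ‖f' x - fN' x‖ ^ 2 ≤ e ^ 2 := by
    have hb : ‖∫ x in (0:ℝ)..1, (‖f' x - fN' x‖ ^ 2 : ℝ)‖ ≤ ∫ x in (0:ℝ)..1, ‖f' x - Q x‖ ^ 2 :=
      intervalIntegral.norm_integral_le_of_norm_le zero_le_one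
        (ae_of_all _ fun t _ => by
          rw [Real.norm_of_nonneg (sq_nonneg _)]
          exact pow_le_pow_left₀ (norm_nonneg _) (hw'_pt t) 2) hd2i
    rw [hesq]
    exact (Real.le_norm_self _).trans hb
  -- conclude with Part 2
  calc mainTermForm (fun x => f x - fN x) (fun x => f' x - fN' x) ≤ 1400 * e ^ 2 :=
        mainTermForm_le_of_bounds' he0 hw_bound hw'i hw'1 hw'2
    _ = 1400 * E2 := by rw [hesq]
    _ ≤ 1400 * e₀ := by nlinarith [hE2le]
    _ = η := by rw [he₀]; ring

/-- **DENSITY OF POLYNOMIAL SHORT PAIRS (the (D11″) approximation hypothesis, PROVED).** Every short pair of kinked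
in-class pieces (`ShortPairs`: `θ_f + θ_g < 1`) is, for every `η > 0`, within `𝔅`-distance `η` in each piece of a
POLYNOMIAL short pair (lengths `min θ_f 1`, `min θ_g 1`, still adding up to `< 1`) — the `hdense` hypothesis of
`crossTablePsiOn_zero_of_dense` / `dualCrossTablePsiOn_zero_of_dense` for `𝒞 = ShortPairs`, `𝒞₀ = PolyShortPairs`.
[cite: Zhang2022LandauSiegel, §7 (7.2) p.13, §8 (8.5) Lemma 8.1 p.16] -/
theorem exists_polyShortPairs_approx {f f' g g' : ℝ → ℂ} (hs : ShortPairs f f' g g') {η : ℝ} (hη : 0 < η) :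
    ∃ fN fN' gN gN' : ℝ → ℂ, InClassPiece fN fN' ∧ InClassPiece gN gN' ∧ PolyShortPairs fN fN' gN gN' ∧
      mainTermForm (fun x => f x - fN x) (fun x => f' x - fN' x) ≤ η ∧
      mainTermForm (fun x => g x - gN x) (fun x => g' x - gN' x) ≤ η := by
  obtain ⟨θf, θg, hsum, hf, hg⟩ := hs
  obtain ⟨fN, fN', hfN, hBf⟩ := hf.min_one.exists_polyShortPiece_approx (min_le_right _ _) hη
  obtain ⟨gN, gN', hgN, hBg⟩ := hg.min_one.exists_polyShortPiece_approx (min_le_right _ _) hη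
  refine ⟨fN, fN', gN, gN', hfN.inClassPiece, hgN.inClassPiece, ⟨min θf 1, min θg 1, ?_, hfN, hgN⟩, hBf, hBg⟩
  linarith [min_le_left θf 1, min_le_left θg 1]

/-- The density hypothesis of the in-tree reductions, for ANY sub-class `𝒞₀` containing the polynomial short pairs.
[cite: Zhang2022LandauSiegel, §7 (7.2) p.13, §8 (8.5) Lemma 8.1 p.16] -/
theorem shortPairs_dense_of_poly {𝒞₀ : PairClass} (h𝒞₀ : ∀ f f' g g', PolyShortPairs f f' g g' → 𝒞₀ f f' g g') :
    ∀ (f f' g g' : ℝ → ℂ), InClassPiece f f' → InClassPiece g g' → ShortPairs f f' g g' → ∀ η : ℝ, 0 < η →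
      ∃ fN fN' gN gN' : ℝ → ℂ, InClassPiece fN fN' ∧ InClassPiece gN gN' ∧ 𝒞₀ fN fN' gN gN' ∧
        mainTermForm (fun x => f x - fN x) (fun x => f' x - fN' x) ≤ η ∧
        mainTermForm (fun x => g x - gN x) (fun x => g' x - gN' x) ≤ η := by
  intro f f' g g' _ _ hs η hη
  obtain ⟨fN, fN', gN, gN', h1, h2, h3, h4, h5⟩ := exists_polyShortPairs_approx hs hη
  exact ⟨fN, fN', gN, gN', h1, h2, h𝒞₀ _ _ _ _ h3, h4, h5⟩

end Density

/-! ### Part 4 — THE PORTS: the three short cells reduce to K0 + darkness on (a class containing) the polynomial short pairs -/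

section Ports

variable {c' : ℝ} {𝒞₀ : PairClass}

/-- **PORT (cross cell, any degree `d`).** If the degree-`d` ψ-graded cross cell is dark on a sub-class `𝒞₀` containing
the polynomial short pairs (OPEN input — for `d = 1` the x₁|short content of DISPLAY #4, for `d = 2` the x₂|short content of
DISPLAY #3; asserted by no one), the side tables K0 hold at `c′` (`InClassMean c′`, stmt-Parity-20016 — OPEN input) and
Lemma 2.3 holds at `c′`, then the cell is dark on ALL kinked short pairs: `CrossTablePsiOn c′ ShortPairs d 0`. The density
leg is Part 3 (PROVED); the rest is `crossTablePsiOn_zero_of_dense` (p521442).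
[cite: Zhang2022LandauSiegel, §2 Lemma 2.3, §7 Prop 7.1 (7.2), §8 (8.5) Lemma 8.1 Lemma 8.2 p.16] -/
theorem crossTablePsiOn_short_zero_of_poly {d : ℕ} (h𝒞₀ : ∀ f f' g g', PolyShortPairs f f' g g' → 𝒞₀ f f' g g')
    (hdark : CrossTablePsiOn c' 𝒞₀ d (fun _ _ _ _ => 0)) (hK0 : InClassMean c') (h23 : Lemma23 c') :
    CrossTablePsiOn c' ShortPairs d (fun _ _ _ _ => 0) :=
  crossTablePsiOn_zero_of_dense hdark hK0 h23 (shortPairs_dense_of_poly h𝒞₀)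

/-- **PORT (dual cell, any degree `d`)** — the y₁|short twin (`d = 1`: DISPLAY #4's Y₁ table): dark on `𝒞₀ ⊇ PolyShortPairs`
+ K0 + Lemma 2.3 at `c′` ⇒ `DualCrossTablePsiOn c′ ShortPairs d 0` (`dualCrossTablePsiOn_zero_of_dense`, p528742, + Part 3).
[cite: Zhang2022LandauSiegel, §2 (2.17) Lemma 2.3, §7 Prop 7.1 (7.2), §8 (8.5) Lemma 8.1 p.16] -/
theorem dualCrossTablePsiOn_short_zero_of_poly {d : ℕ} (h𝒞₀ : ∀ f f' g g', PolyShortPairs f f' g g' → 𝒞₀ f f' g g')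
    (hdark : DualCrossTablePsiOn c' 𝒞₀ d (fun _ _ _ _ => 0)) (hK0 : InClassMean c') (h23 : Lemma23 c') :
    DualCrossTablePsiOn c' ShortPairs d (fun _ _ _ _ => 0) :=
  dualCrossTablePsiOn_zero_of_dense hdark hK0 h23 (shortPairs_dense_of_poly h𝒞₀)

/-- **PORT (the degree-2 cell, x₂|short):** dark on `𝒞₀ ⊇ PolyShortPairs` + K0 + Lemma 2.3 at `c′` ⇒ `TauTwoDarkShort c′`
(p516582). [cite: Zhang2022LandauSiegel, §2 Lemma 2.3, §4 Lemma 4.8 p.9, §7 Prop 7.1 (7.2), §8 (8.5) Lemma 8.1 Lemma 8.2 p.16] -/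
theorem tauTwoDarkShort_of_poly (h𝒞₀ : ∀ f f' g g', PolyShortPairs f f' g g' → 𝒞₀ f f' g g')
    (hdark : CrossTablePsiOn c' 𝒞₀ 2 (fun _ _ _ _ => 0)) (hK0 : InClassMean c') (h23 : Lemma23 c') :
    TauTwoDarkShort c' :=
  crossTablePsiOn_short_zero_of_poly h𝒞₀ hdark hK0 h23

/-- **PORT, eventually in `c′` (cross cell, any degree; the shape of the route items).** With K0 in the route's form
`∃ c₀, ∀ c′ ≥ c₀, InClassMean c′` (stmt-Parity-20016) and darkness on `𝒞₀ ⊇ PolyShortPairs` for all large `c′` (allowed to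
use K0 at the same `c′`), the degree-`d` cross cell is dark on all short pairs for all large `c′` — for `d = 1` this is
the `hX` input of the kill path `Theorems.shortPairsSchurClose_iff_notAEventually_of_dark` and gives
`ShortPairsCrossDegOne` with `X₁ := 0` (`Theorems.shortPairsCrossDegOne_of_dark`, p531342); Lemma 2.3 is discharged by
the tree (`lemma23_eventually`). [cite: Zhang2022LandauSiegel, §2 Lemma 2.3, §8 (8.5) Lemma 8.1 p.16] -/
theorem crossTablePsiOn_short_zero_eventually_of_poly {d : ℕ}
    (h𝒞₀ : ∀ f f' g g', PolyShortPairs f f' g g' → 𝒞₀ f f' g g')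
    (hK0 : ∃ c₀ : ℝ, ∀ c' : ℝ, c₀ ≤ c' → InClassMean c')
    (hdark : ∃ c₀ : ℝ, ∀ c' : ℝ, c₀ ≤ c' → InClassMean c' → CrossTablePsiOn c' 𝒞₀ d (fun _ _ _ _ => 0)) :
    ∃ c₀ : ℝ, ∀ c' : ℝ, c₀ ≤ c' → CrossTablePsiOn c' ShortPairs d (fun _ _ _ _ => 0) := by
  obtain ⟨c₁, h₁⟩ := hK0
  obtain ⟨c₂, h₂⟩ := hdark
  obtain ⟨c₃, -, h₃⟩ := lemma23_eventually
  refine ⟨max (max c₁ c₂) c₃, fun c' hc' => ?_⟩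
  have hc1 : c₁ ≤ c' := le_trans (le_trans (le_max_left _ _) (le_max_left _ _)) hc'
  have hc2 : c₂ ≤ c' := le_trans (le_trans (le_max_right _ _) (le_max_left _ _)) hc'
  have hc3 : c₃ ≤ c' := le_trans (le_max_right _ _) hc'
  exact crossTablePsiOn_short_zero_of_poly h𝒞₀ (h₂ c' hc2 (h₁ c' hc1)) (h₁ c' hc1) (h₃ c' hc3)

/-- **PORT, eventually in `c′` (dual cell, any degree)** — for `d = 1` the `hY` input of the kill path and
`ShortPairsDualDegOne` with `Y₁ := 0` (`Theorems.shortPairsDualDegOne_of_dark`, p531342).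
[cite: Zhang2022LandauSiegel, §2 (2.17) Lemma 2.3, §8 (8.5) Lemma 8.1 p.16] -/
theorem dualCrossTablePsiOn_short_zero_eventually_of_poly {d : ℕ}
    (h𝒞₀ : ∀ f f' g g', PolyShortPairs f f' g g' → 𝒞₀ f f' g g')
    (hK0 : ∃ c₀ : ℝ, ∀ c' : ℝ, c₀ ≤ c' → InClassMean c')
    (hdark : ∃ c₀ : ℝ, ∀ c' : ℝ, c₀ ≤ c' → InClassMean c' → DualCrossTablePsiOn c' 𝒞₀ d (fun _ _ _ _ => 0)) :
    ∃ c₀ : ℝ, ∀ c' : ℝ, c₀ ≤ c' → DualCrossTablePsiOn c' ShortPairs d (fun _ _ _ _ => 0) := by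
  obtain ⟨c₁, h₁⟩ := hK0
  obtain ⟨c₂, h₂⟩ := hdark
  obtain ⟨c₃, -, h₃⟩ := lemma23_eventually
  refine ⟨max (max c₁ c₂) c₃, fun c' hc' => ?_⟩
  have hc1 : c₁ ≤ c' := le_trans (le_trans (le_max_left _ _) (le_max_left _ _)) hc'
  have hc2 : c₂ ≤ c' := le_trans (le_trans (le_max_right _ _) (le_max_left _ _)) hc'
  have hc3 : c₃ ≤ c' := le_trans (le_max_right _ _) hc'
  exact dualCrossTablePsiOn_short_zero_of_poly h𝒞₀ (h₂ c' hc2 (h₁ c' hc1)) (h₁ c' hc1) (h₃ c' hc3)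

/-- **PORT, eventually in `c′` (the degree-2 cell):** K0 (route form) + x₂-darkness on `𝒞₀ ⊇ PolyShortPairs` for all large
`c′` ⇒ `∃ c₀, ∀ c′ ≥ c₀, TauTwoDarkShort c′` — the statement of the route item stmt-Parity-20429 `ShortPairsTauTwoDark`,
MODULO its two open inputs. [cite: Zhang2022LandauSiegel, §2 Lemma 2.3, §4 Lemma 4.8 p.9, §8 (8.5) Lemma 8.1 Lemma 8.2 p.16] -/
theorem tauTwoDarkShort_eventually_of_poly
    (h𝒞₀ : ∀ f f' g g', PolyShortPairs f f' g g' → 𝒞₀ f f' g g')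
    (hK0 : ∃ c₀ : ℝ, ∀ c' : ℝ, c₀ ≤ c' → InClassMean c')
    (hdark : ∃ c₀ : ℝ, ∀ c' : ℝ, c₀ ≤ c' → InClassMean c' → CrossTablePsiOn c' 𝒞₀ 2 (fun _ _ _ _ => 0)) :
    ∃ c₀ : ℝ, ∀ c' : ℝ, c₀ ≤ c' → TauTwoDarkShort c' :=
  crossTablePsiOn_short_zero_eventually_of_poly h𝒞₀ hK0 hdark

end Ports

end Literature.NumberTheory.LFunctions.Zhang2022.KnifeEdge

end
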